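import Literature.MathematicalPhysics.QuantumFieldTheory.Balaban1983to89.B8SectEKLevelFamilyLipschitz
import Literature.MathematicalPhysics.QuantumFieldTheory.Balaban1983to89.B8Prop5JoinSectE

/-!
# `Balaban1983to89.B8SectEKLevelFamilyBase` — [Balaban1985RegularSpaces] Sect. E pp. 95–97: `D′` AT THE SHIFTED BASE POINT `−iλ_s + H′t̂` OF THE
# ¼α₄-BALL OF (1.102) — existence, Lipschitz, reality — FOR AN ABSTRACT REMAINDER FAMILY AND AN INHOMOGENEOUS TARGET; the Sect. E half of the letter `Hc` that
# JOIN-A∕B (`B8Prop5GaugeParamKLevel.gaugeParam_kLevel`, `B8Prop5JoinHFP.hFP_kLevel`, the cell's restriction-agnostic `hFP_kLevel_agnostic_RD`)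
# consume through `hc0 hc1 hc2 hcL0 hcL1 hcL2 hcsa hcsupp`, built as `H_c λ := i·H′(t̂ − D′(−iλ + H′t̂))` from the family `D′` of
# `B8SectEKLevelFamily` (remainder `Cfam j`, rows (1.121)∕(1.125) displayed) and a displayed skew datum `t̂ : 𝔅_k → 𝔤` (the value the
# linearised restriction functional is to take — `t̂ = 0` is print's case (1.114) «Q′(λ − H′D′(λ)) = Q′λ» with `Q′λ = 0`)

statement-level skeleton of published theorems with citation tags; proofs where landed; nothing here is a claim about the Yang–Mills mass gap

T. Bałaban, *Spaces of regular gauge field configurations on a lattice and gauge fixing conditions*, Commun. Math. Phys. **99** (1985)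
75–102 `[Balaban1985RegularSpaces]` ("B8"; printed page = PDF page + 74), pp. 91–97 [PDF 17–23].  PDF held:
`paper:balaban1985-cmp99-regular-spaces-gauge-fixing`.  STATUS: published, refereed.

THE PRINTED TEXT (p. 92 [PDF 18]): «In the next section we will prove that for α₃, α₄ sufficiently small there exists a function D′(u₁, λ) such
that the change of variables λ → λ − H′D′(u₁, λ) transforms the function Q′(u₁, λ) into Q′λ. The function D′(u₁, λ) is analytic in λ, defined
on a set of λ satisfying (1.77) with ½α₄ instead of α₄, and is bounded by C′₂(α₃ + α₄)α₄ …»; (p. 95) «λ′ = λ − H′D′(λ) (1.113) changes the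
function Q′(λ′) into the linear function Q′λ»; (p. 97) «This solution is an analytic function of λ … |D′(λ)| = |C′(λ − H′D′(λ))| < C′₂(α₃ + α₄)α₄.»

## WHY THIS FILE (cell `ym3-torus`, HUMAN RULING D-0037 — YM₃ on T³ is ladder rung R3, not the Clay problem; seat `ym-ust-19936-w8` g0∕s2,
★★OWNER ym3-torus-plan g26 ACK 45 (b) row «J4b», LEAD-H `ym-ust-19200-w5` g4 T2♭-PLAN v1.1 #46 J4; `--supports stmt-QuantumFields-19200`)

The route's P1♭ `core` asks [B8] Prop. 5 at the top level with the cell's normalisation (o) in place of print's restriction (1.29)_k.  Prop. 5's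
k-level machine in the tree is restriction-AGNOSTIC except where the Sect. E correction is BUILT (JOIN-C `B8Prop5JoinSectE.exists_Dprime_map` reads
[3]'s concrete remainder `Cnl`) — the cell's J4c (`hFP_kLevel_agnostic_RD`, seat `ym-ust-19936-w3` g6) takes `Hc` as a free letter with the eight
binders below.  THIS FILE supplies that letter for ANY remainder family `Cfam` (instance of record: `Cnl` at the levels `j < k`, the (o)-remainder
at `j = k`, rows from the cell's tower file) and ANY skew target `t̂` (the inhomogeneous (o) datum), with the sizes `h₀ = h₁ = B′₀(Cb + ‖t̂‖)`,
`h₂ = B′₂(Cb + ‖t̂‖)`, moduli `l₀ = l₁ = 2B′₀·Cl`, `l₂ = 2B′₂·Cl`, reality and support, AND the TRANSFER clause exposing, for every `λ_s` in the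
¼α₄-ball, the solution `X_s = D′(−iλ_s + H′t̂)` with `−i(λ_s + H_cλ_s) = −iλ_s + H′t̂ − H′X_s` — from which a consumer holding a decomposition
`Qfull j μ y = Qlin j μ y + Cfam j μ y` reads `Qfull j (−iλ′) y = Qlin j (−iλ_s) y + t̂(j, y)` by `B8SectEKLevelFamily.eq1114_of_fixedPoint_kLevel_fam`.

## WHAT IS CERTIFIED HERE (kernel; theorems only; no `sorry`, no `def`, no `instance`, no `notation`)

* §1 `base_sub_119`, `base_diff_modulus` — the shifted base point `−iλ_s + H′t̂` of the ¼α₄-ball lies in Sect. E's half-size set (1.119) on every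
  tower when `B′₀‖t̂‖ < ¼α₄`; its difference modulus between `s` and `t` is `‖s − t‖` (JOIN-C's `ball_sub_119`∕`ball_diff_modulus` + (1.92) for `H′t̂`).
* §2 `familyE_exists`, `familyE_lipschitz`, `familyE_real` — `D′` at the shifted base point: existence in the ball with `‖X‖ ≤ Cb`, zero off `𝔅_k`,
  (1.117); Lipschitz `2·Cl·‖s − t‖`; skew for Hermitian `λ_s` under the displayed covariance of `Cfam` (`hCreal`) and of `H′` (`hHequiv`), `t̂` skew.
* (sibling `B8SectEKLevelFamilyHc`: ★ `exists_Hc_of_family` — the letter `Hc` with the eight JOIN binders and the transfer clause.)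

## HONEST SCOPE

Assembly over `B8SectEKLevelFamily(Lipschitz)` and JOIN-C's public bookkeeping; every analytic input is a displayed hypothesis (the family rows
(1.121)∕(1.125) and covariance, [4]'s `H′` letters (1.92)₀,₁,₂ ∕ range ∕ covariance, the target's size and skewness).  Nothing here discharges
those rows, nothing here is Prop. 5 or Theorem 4, nothing continuum ∕ ℝ⁴ ∕ OS ∕ mass-gap ∕ Clay.  2026-08-28.
-/

noncomputable section

open NormedSpace
open Complex (I)

namespace Literature.MathematicalPhysics.QuantumFieldTheory.Balaban1983to89.B8SectEKLevelFamilyBase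

open B7Prop1Explicit B7Prop1Local
open B7Eq170Flat (cj cj_apply cj_add)
open B8Ineq130 (tlo thi)
open B8Ineq132 (covDerivFwd)
open B8Eq138LandauZd (covLap)
open B8Eq1122Concrete (cjDiff_sub)
open B8Eq1123Concrete (cj_smul_complex)
open B8Eq1117Concrete (XSpace)
open B8Eq1117KLevel (dom120_of_119_tower)
open B8Eq151V2Divergence (covDerivFwd_smul)
open B8LambdaSpaceKLevel (wt lamSubK lamOf norm_lamOf_le norm_cjDiff_lamOf_le lamOf_sub ext_of_lamOf)
open B8Prop5ContractionKLevel (Bd2)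
open B8Prop5KLevelLetters (covLap_sub)
open B8Prop5JoinSectE (cjDiff_le_of_weighted covLap_smul ball_sub_119 ball_diff_modulus hH1_tower)
open B8SectEKLevelFamily (exists_Dprime_kLevel_fam)
open B8SectEKLevelFamilyLipschitz (Dprime_lipschitz_kLevel_fam)

-- `Site` alone could resolve to the torus sites of `Setup.lean`; re-export the `ℤ^d` sites of `B7Prop1Explicit`.
export B7Prop1Explicit (Site)

variable {d : ℕ} {𝔸 : Type*} [CStarAlgebra 𝔸]

/-! ## §0 Bookkeeping: the scalars `±i` -/

section Bookkeeping

/-- `‖(−i)·a‖ = ‖a‖`. [folklore] -/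
private theorem norm_negI_smul (a : 𝔸) : ‖(-I) • a‖ = ‖a‖ := by
  rw [norm_smul, norm_neg, Complex.norm_I, one_mul]

/-- `((−i)·a)⋆ = i·a⋆`. [folklore] -/
private theorem star_negI_smul (a : 𝔸) : star ((-I) • a) = I • star a := by
  rw [star_smul, star_neg, Complex.star_def, Complex.conj_I, neg_neg]

/-- For Hermitian `a`, `((−i)·a)⋆ = −((−i)·a)` (skew). [folklore] -/
private theorem star_negI_smul_of_sa {a : 𝔸} (ha : IsSelfAdjoint a) : star ((-I) • a) = -((-I) • a) := by
  rw [star_negI_smul, ha.star_eq, neg_smul, neg_neg]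

end Bookkeeping

/-! ## §1 The shifted base point `−iλ_s + H′t̂` of the ¼α₄-ball lies in Sect. E's set (1.119), tower by tower -/

section Base

variable {L k : ℕ} {η : ℝ} {Λs : ℕ → Set (Site d)} {Eb : ℕ → Set (Site d × Fin d)} {U₀ : Site d → Fin d → 𝔸ˣ}

/-- **(1.102)-ball + small target ⇒ (1.119) on the towers for the SHIFTED base point `λ_E := −iλ_s + H′t̂`**: if `‖s‖ ≤ ¼α₄`, `B′₀‖t̂‖ < ¼α₄`,
`H′` obeys (1.92)₀,₁ and every bond of the tower `Bʲ(y)`, `y ∈ Λ_j`, is a bond of `Eb j`, then `‖λ_E(x)‖ < ½α₄` on the tower and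
`‖R(U₀(b))λ_E(b₊) − λ_E(b₋)‖ < ½α₄·L^{−j}` on its bonds. [cite: Balaban1985RegularSpaces, (1.102) p.93, (1.119) p.96, (1.92) p.91] -/
theorem base_sub_119 (hL : 1 ≤ L) (hη : 0 < η) {α₄ B₀' : ℝ} (H' : XSpace d k 𝔸 →ₗ[ℂ] (Site d → 𝔸))
    (hEbT : ∀ j, j ≤ k → ∀ y ∈ Λs j, ∀ (x : Site d) (κ : Fin d), InBox (tlo L y j) (thi L y j) x →
      InBox (tlo L y j) (thi L y j) (x + e κ) → (x, κ) ∈ Eb j)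
    (hH0 : ∀ (X : XSpace d k 𝔸) (x : Site d), ‖H' X x‖ ≤ B₀' * ‖X‖)
    (hH1 : ∀ j, j ≤ k → ∀ (X : XSpace d k 𝔸), ∀ p ∈ Eb j, wt L η j * ‖covDerivFwd η U₀ p.2 (H' X) p.1‖ ≤ B₀' * ‖X‖)
    (th : XSpace d k 𝔸) (hτ : B₀' * ‖th‖ < α₄ / 4)
    (s : lamSubK η U₀ L k Eb) (hs : ‖s‖ ≤ α₄ / 4) :
    (∀ j, j ≤ k → ∀ y ∈ Λs j, ∀ x : Site d, InBox (tlo L y j) (thi L y j) x → ‖((-I) • lamOf s + H' th) x‖ < α₄ / 2) ∧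
      ∀ j, j ≤ k → ∀ y ∈ Λs j, ∀ (x : Site d) (κ : Fin d), InBox (tlo L y j) (thi L y j) x →
        InBox (tlo L y j) (thi L y j) (x + e κ) →
          ‖cj (U₀ x κ) (((-I) • lamOf s + H' th) (x + e κ)) - ((-I) • lamOf s + H' th) x‖ < α₄ / 2 * ((L : ℝ) ^ j)⁻¹ := by
  refine ⟨fun j _ y _ x _ => ?_, fun j hj y hy x κ hx hxe => ?_⟩
  · rw [Pi.add_apply, Pi.smul_apply]
    calc ‖(-I) • lamOf s x + H' th x‖ ≤ ‖(-I) • lamOf s x‖ + ‖H' th x‖ := norm_add_le _ _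
      _ ≤ α₄ / 4 + B₀' * ‖th‖ := by rw [norm_negI_smul]; exact add_le_add ((norm_lamOf_le s x).trans hs) (hH0 th x)
      _ < α₄ / 2 := by linarith
  · have hLj : (0 : ℝ) < ((L : ℝ) ^ j)⁻¹ := by
      have : (0 : ℝ) < L := by exact_mod_cast hL
      positivity
    have hsplit : cj (U₀ x κ) (((-I) • lamOf s + H' th) (x + e κ)) - ((-I) • lamOf s + H' th) x =
        ((-I) • (cj (U₀ x κ) (lamOf s (x + e κ)) - lamOf s x)) + (cj (U₀ x κ) (H' th (x + e κ)) - H' th x) := by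
      rw [Pi.add_apply, Pi.add_apply, Pi.smul_apply, Pi.smul_apply, cj_add, cj_smul_complex, smul_sub]
      abel
    rw [hsplit]
    calc ‖(-I) • (cj (U₀ x κ) (lamOf s (x + e κ)) - lamOf s x) + (cj (U₀ x κ) (H' th (x + e κ)) - H' th x)‖
        ≤ ‖(-I) • (cj (U₀ x κ) (lamOf s (x + e κ)) - lamOf s x)‖ + ‖cj (U₀ x κ) (H' th (x + e κ)) - H' th x‖ := norm_add_le _ _
      _ ≤ ‖s‖ * ((L : ℝ) ^ j)⁻¹ + B₀' * ‖th‖ * ((L : ℝ) ^ j)⁻¹ := by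
          rw [norm_negI_smul]
          exact add_le_add (norm_cjDiff_lamOf_le hL hη s hj (hEbT j hj y hy x κ hx hxe))
            (cjDiff_le_of_weighted hL hη (hH1 j hj th (x, κ) (hEbT j hj y hy x κ hx hxe)))
      _ ≤ α₄ / 4 * ((L : ℝ) ^ j)⁻¹ + B₀' * ‖th‖ * ((L : ℝ) ^ j)⁻¹ := by gcongr
      _ < α₄ / 2 * ((L : ℝ) ^ j)⁻¹ := by nlinarith

/-- **The difference modulus of the shifted base points is `‖s − t‖`** (the target term cancels): sites and bonds of every tower.
[cite: Balaban1985RegularSpaces, (1.105)–(1.106) p.94, (1.125) p.97] -/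
theorem base_diff_modulus (hL : 1 ≤ L) (hη : 0 < η) (H' : XSpace d k 𝔸 →ₗ[ℂ] (Site d → 𝔸))
    (hEbT : ∀ j, j ≤ k → ∀ y ∈ Λs j, ∀ (x : Site d) (κ : Fin d), InBox (tlo L y j) (thi L y j) x →
      InBox (tlo L y j) (thi L y j) (x + e κ) → (x, κ) ∈ Eb j)
    (th : XSpace d k 𝔸) (s t : lamSubK η U₀ L k Eb) :
    (∀ j, j ≤ k → ∀ y ∈ Λs j, ∀ x : Site d, InBox (tlo L y j) (thi L y j) x →
      ‖(((-I) • lamOf s + H' th) - ((-I) • lamOf t + H' th)) x‖ ≤ ‖s - t‖) ∧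
      ∀ j, j ≤ k → ∀ y ∈ Λs j, ∀ (x : Site d) (κ : Fin d), InBox (tlo L y j) (thi L y j) x →
        InBox (tlo L y j) (thi L y j) (x + e κ) →
          ‖cj (U₀ x κ) ((((-I) • lamOf s + H' th) - ((-I) • lamOf t + H' th)) (x + e κ)) -
              (((-I) • lamOf s + H' th) - ((-I) • lamOf t + H' th)) x‖ ≤ ‖s - t‖ * ((L : ℝ) ^ j)⁻¹ := by
  have hfun : ((-I) • lamOf s + H' th) - ((-I) • lamOf t + H' th) = (-I) • lamOf s - (-I) • lamOf t := by abel
  rw [hfun]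
  exact ball_diff_modulus (Λs := Λs) hL hη hEbT s t

end Base

/-! ## §2 `D′` at the shifted base point: existence, Lipschitz, reality — from the family file -/

section FamilyE

variable {L k : ℕ} {η : ℝ} {Λs : ℕ → Set (Site d)} {Eb : ℕ → Set (Site d × Fin d)} {U₀ : Site d → Fin d → 𝔸ˣ}
  {α₄ B₀' Cb Cl : ℝ} {Cfam : ℕ → (Site d → 𝔸) → Site d → 𝔸}

/-- **`D′(−iλ_s + H′t̂)` EXISTS IN THE BALL, for the family** (`B8SectEKLevelFamily.exists_Dprime_kLevel_fam` at the shifted base point): size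
`‖X‖ ≤ α₄∕(2B′₀)` and `‖X‖ ≤ Cb`, zero off `𝔅_k`, (1.117) `Cfam j (−iλ_s + H′t̂ − H′X) y = X(j, y)` on `𝔅_k`.
[cite: Balaban1985RegularSpaces, (1.113)–(1.121) pp.95–97, p.97] -/
theorem familyE_exists (hL : 1 ≤ L) (hη : 0 < η) (H' : XSpace d k 𝔸 →ₗ[ℂ] (Site d → 𝔸))
    (hα₄ : 0 < α₄) (hB : 0 < B₀') (hCb : 0 ≤ Cb)
    (hEbT : ∀ j, j ≤ k → ∀ y ∈ Λs j, ∀ (x : Site d) (κ : Fin d), InBox (tlo L y j) (thi L y j) x →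
      InBox (tlo L y j) (thi L y j) (x + e κ) → (x, κ) ∈ Eb j)
    (hH0 : ∀ (X : XSpace d k 𝔸) (x : Site d), ‖H' X x‖ ≤ B₀' * ‖X‖)
    (hH1 : ∀ j, j ≤ k → ∀ (X : XSpace d k 𝔸), ∀ p ∈ Eb j, wt L η j * ‖covDerivFwd η U₀ p.2 (H' X) p.1‖ ≤ B₀' * ‖X‖)
    (hC121 : ∀ j, j ≤ k → ∀ y ∈ Λs j, ∀ μ : Site d → 𝔸,
      (∀ x : Site d, InBox (tlo L y j) (thi L y j) x → ‖μ x‖ < α₄) →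
      (∀ (x : Site d) (κ : Fin d), InBox (tlo L y j) (thi L y j) x → InBox (tlo L y j) (thi L y j) (x + e κ) →
        ‖cj (U₀ x κ) (μ (x + e κ)) - μ x‖ < α₄ * ((L : ℝ) ^ j)⁻¹) →
      ‖Cfam j μ y‖ ≤ Cb)
    (hC125 : ∀ j, j ≤ k → ∀ y ∈ Λs j, ∀ (μ₁ μ₂ : Site d → 𝔸) (m : ℝ), 0 ≤ m →
      (∀ x : Site d, InBox (tlo L y j) (thi L y j) x → ‖μ₁ x‖ < α₄) →
      (∀ (x : Site d) (κ : Fin d), InBox (tlo L y j) (thi L y j) x → InBox (tlo L y j) (thi L y j) (x + e κ) →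
        ‖cj (U₀ x κ) (μ₁ (x + e κ)) - μ₁ x‖ < α₄ * ((L : ℝ) ^ j)⁻¹) →
      (∀ x : Site d, InBox (tlo L y j) (thi L y j) x → ‖μ₂ x‖ < α₄) →
      (∀ (x : Site d) (κ : Fin d), InBox (tlo L y j) (thi L y j) x → InBox (tlo L y j) (thi L y j) (x + e κ) →
        ‖cj (U₀ x κ) (μ₂ (x + e κ)) - μ₂ x‖ < α₄ * ((L : ℝ) ^ j)⁻¹) →
      (∀ x : Site d, InBox (tlo L y j) (thi L y j) x → ‖(μ₁ - μ₂) x‖ ≤ m) →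
      (∀ (x : Site d) (κ : Fin d), InBox (tlo L y j) (thi L y j) x → InBox (tlo L y j) (thi L y j) (x + e κ) →
        ‖cj (U₀ x κ) ((μ₁ - μ₂) (x + e κ)) - (μ₁ - μ₂) x‖ ≤ m * ((L : ℝ) ^ j)⁻¹) →
      ‖Cfam j μ₁ y - Cfam j μ₂ y‖ ≤ Cl * m)
    (hCbρ : Cb ≤ α₄ / (2 * B₀')) (hClB : Cl * B₀' ≤ 1 / 2)
    (th : XSpace d k 𝔸) (hτ : B₀' * ‖th‖ < α₄ / 4)
    (s : lamSubK η U₀ L k Eb) (hs : ‖s‖ ≤ α₄ / 4) :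
    ∃ X : XSpace d k 𝔸, ‖X‖ ≤ α₄ / (2 * B₀') ∧ ‖X‖ ≤ Cb ∧
      (∀ (j : ℕ) (hj : j ≤ k) (y : Site d), y ∉ Λs j → X (⟨j, Nat.lt_succ_of_le hj⟩, y) = 0) ∧
      ∀ (j : ℕ) (hj : j ≤ k) (y : Site d), y ∈ Λs j →
        Cfam j (((-I) • lamOf s + H' th) - H' X) y = X (⟨j, Nat.lt_succ_of_le hj⟩, y) := by
  obtain ⟨h119b, h119a⟩ := base_sub_119 (Λs := Λs) hL hη H' hEbT hH0 hH1 th hτ s hs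
  exact exists_Dprime_kLevel_fam (Λ := Λs) (lam := (-I) • lamOf s + H' th) hα₄ hB hCb h119b h119a hH0 (hH1_tower hL hη H' hEbT hH1)
    hC121 hC125 hCbρ hClB

/-- **`D′` AT THE SHIFTED BASE POINT IS LIPSCHITZ ON THE ¼α₄-BALL WITH THE (1.102) NORM, for the family**: two solutions in the ball at `s`, `t`
satisfy `‖X_s − X_t‖ ≤ 2·Cl·‖s − t‖` (`B8SectEKLevelFamilyLipschitz.Dprime_lipschitz_kLevel_fam`; at `s = t`: «exactly one solution»).
[cite: Balaban1985RegularSpaces, p.97 (after (1.125)), (1.105)–(1.106) p.94] -/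
theorem familyE_lipschitz (hL : 1 ≤ L) (hη : 0 < η) (H' : XSpace d k 𝔸 →ₗ[ℂ] (Site d → 𝔸))
    (hB : 0 < B₀') (hCl : 0 ≤ Cl)
    (hEbT : ∀ j, j ≤ k → ∀ y ∈ Λs j, ∀ (x : Site d) (κ : Fin d), InBox (tlo L y j) (thi L y j) x →
      InBox (tlo L y j) (thi L y j) (x + e κ) → (x, κ) ∈ Eb j)
    (hH0 : ∀ (X : XSpace d k 𝔸) (x : Site d), ‖H' X x‖ ≤ B₀' * ‖X‖)
    (hH1 : ∀ j, j ≤ k → ∀ (X : XSpace d k 𝔸), ∀ p ∈ Eb j, wt L η j * ‖covDerivFwd η U₀ p.2 (H' X) p.1‖ ≤ B₀' * ‖X‖)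
    (hC125 : ∀ j, j ≤ k → ∀ y ∈ Λs j, ∀ (μ₁ μ₂ : Site d → 𝔸) (m : ℝ), 0 ≤ m →
      (∀ x : Site d, InBox (tlo L y j) (thi L y j) x → ‖μ₁ x‖ < α₄) →
      (∀ (x : Site d) (κ : Fin d), InBox (tlo L y j) (thi L y j) x → InBox (tlo L y j) (thi L y j) (x + e κ) →
        ‖cj (U₀ x κ) (μ₁ (x + e κ)) - μ₁ x‖ < α₄ * ((L : ℝ) ^ j)⁻¹) →
      (∀ x : Site d, InBox (tlo L y j) (thi L y j) x → ‖μ₂ x‖ < α₄) →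
      (∀ (x : Site d) (κ : Fin d), InBox (tlo L y j) (thi L y j) x → InBox (tlo L y j) (thi L y j) (x + e κ) →
        ‖cj (U₀ x κ) (μ₂ (x + e κ)) - μ₂ x‖ < α₄ * ((L : ℝ) ^ j)⁻¹) →
      (∀ x : Site d, InBox (tlo L y j) (thi L y j) x → ‖(μ₁ - μ₂) x‖ ≤ m) →
      (∀ (x : Site d) (κ : Fin d), InBox (tlo L y j) (thi L y j) x → InBox (tlo L y j) (thi L y j) (x + e κ) →
        ‖cj (U₀ x κ) ((μ₁ - μ₂) (x + e κ)) - (μ₁ - μ₂) x‖ ≤ m * ((L : ℝ) ^ j)⁻¹) →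
      ‖Cfam j μ₁ y - Cfam j μ₂ y‖ ≤ Cl * m)
    (hClB : Cl * B₀' ≤ 1 / 2)
    (th : XSpace d k 𝔸) (hτ : B₀' * ‖th‖ < α₄ / 4)
    (s t : lamSubK η U₀ L k Eb) (hs : ‖s‖ ≤ α₄ / 4) (ht : ‖t‖ ≤ α₄ / 4)
    {X Y : XSpace d k 𝔸} (hXρ : ‖X‖ ≤ α₄ / (2 * B₀')) (hYρ : ‖Y‖ ≤ α₄ / (2 * B₀'))
    (hXzero : ∀ (j : ℕ) (hj : j ≤ k) (y : Site d), y ∉ Λs j → X (⟨j, Nat.lt_succ_of_le hj⟩, y) = 0)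
    (hXfix : ∀ (j : ℕ) (hj : j ≤ k) (y : Site d), y ∈ Λs j →
      Cfam j (((-I) • lamOf s + H' th) - H' X) y = X (⟨j, Nat.lt_succ_of_le hj⟩, y))
    (hYzero : ∀ (j : ℕ) (hj : j ≤ k) (y : Site d), y ∉ Λs j → Y (⟨j, Nat.lt_succ_of_le hj⟩, y) = 0)
    (hYfix : ∀ (j : ℕ) (hj : j ≤ k) (y : Site d), y ∈ Λs j →
      Cfam j (((-I) • lamOf t + H' th) - H' Y) y = Y (⟨j, Nat.lt_succ_of_le hj⟩, y)) :
    ‖X - Y‖ ≤ 2 * Cl * ‖s - t‖ := by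
  obtain ⟨h₁b, h₁a⟩ := base_sub_119 (Λs := Λs) hL hη H' hEbT hH0 hH1 th hτ s hs
  obtain ⟨h₂b, h₂a⟩ := base_sub_119 (Λs := Λs) hL hη H' hEbT hH0 hH1 th hτ t ht
  obtain ⟨hmb, hma⟩ := base_diff_modulus (Λs := Λs) hL hη H' hEbT th s t
  exact Dprime_lipschitz_kLevel_fam (Λ := Λs) (lam₁ := (-I) • lamOf s + H' th) (lam₂ := (-I) • lamOf t + H' th) hB hCl (norm_nonneg _)
    h₁b h₁a h₂b h₂a hmb hma hH0 (hH1_tower hL hη H' hEbT hH1) hC125 hClB hXρ hYρ hXzero hXfix hYzero hYfix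

/-- **`D′(−iλ_s + H′t̂)` IS SKEW FOR HERMITIAN `λ_s` AND SKEW `t̂`** (tacit in print, everything being `U(N)`∕`𝔤`-valued): if the family is covariant
under `μ ↦ −μ⋆` on the (1.120)-set of each tower (`hCreal`) and `H′` under `X ↦ −X⋆` (`hHequiv`), then the reflected configuration `−X⋆` solves the
same equation in the same ball, so by «exactly one solution» (`familyE_lipschitz` at `s = t`) `X(j, y)⋆ = −X(j, y)`.
[cite: Balaban1985RegularSpaces, p.97 (exactly one solution), p.93 (real configurations); Balaban1985Averaging, (22)–(23) p.21] -/
theorem familyE_real (hL : 1 ≤ L) (hη : 0 < η) (H' : XSpace d k 𝔸 →ₗ[ℂ] (Site d → 𝔸))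
    (hB : 0 < B₀') (hCl : 0 ≤ Cl)
    (hEbT : ∀ j, j ≤ k → ∀ y ∈ Λs j, ∀ (x : Site d) (κ : Fin d), InBox (tlo L y j) (thi L y j) x →
      InBox (tlo L y j) (thi L y j) (x + e κ) → (x, κ) ∈ Eb j)
    (hH0 : ∀ (X : XSpace d k 𝔸) (x : Site d), ‖H' X x‖ ≤ B₀' * ‖X‖)
    (hH1 : ∀ j, j ≤ k → ∀ (X : XSpace d k 𝔸), ∀ p ∈ Eb j, wt L η j * ‖covDerivFwd η U₀ p.2 (H' X) p.1‖ ≤ B₀' * ‖X‖)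
    (hHequiv : ∀ X Y : XSpace d k 𝔸, (∀ p, Y p = -star (X p)) → ∀ x, H' Y x = -star (H' X x))
    (hC125 : ∀ j, j ≤ k → ∀ y ∈ Λs j, ∀ (μ₁ μ₂ : Site d → 𝔸) (m : ℝ), 0 ≤ m →
      (∀ x : Site d, InBox (tlo L y j) (thi L y j) x → ‖μ₁ x‖ < α₄) →
      (∀ (x : Site d) (κ : Fin d), InBox (tlo L y j) (thi L y j) x → InBox (tlo L y j) (thi L y j) (x + e κ) →
        ‖cj (U₀ x κ) (μ₁ (x + e κ)) - μ₁ x‖ < α₄ * ((L : ℝ) ^ j)⁻¹) →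
      (∀ x : Site d, InBox (tlo L y j) (thi L y j) x → ‖μ₂ x‖ < α₄) →
      (∀ (x : Site d) (κ : Fin d), InBox (tlo L y j) (thi L y j) x → InBox (tlo L y j) (thi L y j) (x + e κ) →
        ‖cj (U₀ x κ) (μ₂ (x + e κ)) - μ₂ x‖ < α₄ * ((L : ℝ) ^ j)⁻¹) →
      (∀ x : Site d, InBox (tlo L y j) (thi L y j) x → ‖(μ₁ - μ₂) x‖ ≤ m) →
      (∀ (x : Site d) (κ : Fin d), InBox (tlo L y j) (thi L y j) x → InBox (tlo L y j) (thi L y j) (x + e κ) →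
        ‖cj (U₀ x κ) ((μ₁ - μ₂) (x + e κ)) - (μ₁ - μ₂) x‖ ≤ m * ((L : ℝ) ^ j)⁻¹) →
      ‖Cfam j μ₁ y - Cfam j μ₂ y‖ ≤ Cl * m)
    (hCreal : ∀ j, j ≤ k → ∀ y ∈ Λs j, ∀ μ : Site d → 𝔸,
      (∀ x : Site d, InBox (tlo L y j) (thi L y j) x → ‖μ x‖ < α₄) →
      (∀ (x : Site d) (κ : Fin d), InBox (tlo L y j) (thi L y j) x → InBox (tlo L y j) (thi L y j) (x + e κ) →
        ‖cj (U₀ x κ) (μ (x + e κ)) - μ x‖ < α₄ * ((L : ℝ) ^ j)⁻¹) →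
      Cfam j (fun x => -star (μ x)) y = -star (Cfam j μ y))
    (hClB : Cl * B₀' ≤ 1 / 2)
    (th : XSpace d k 𝔸) (hτ : B₀' * ‖th‖ < α₄ / 4) (hth : ∀ p, star (th p) = -th p)
    (s : lamSubK η U₀ L k Eb) (hs : ‖s‖ ≤ α₄ / 4) (hsa : ∀ x, IsSelfAdjoint (lamOf s x))
    {X : XSpace d k 𝔸} (hXρ : ‖X‖ ≤ α₄ / (2 * B₀'))
    (hXzero : ∀ (j : ℕ) (hj : j ≤ k) (y : Site d), y ∉ Λs j → X (⟨j, Nat.lt_succ_of_le hj⟩, y) = 0)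
    (hXfix : ∀ (j : ℕ) (hj : j ≤ k) (y : Site d), y ∈ Λs j →
      Cfam j (((-I) • lamOf s + H' th) - H' X) y = X (⟨j, Nat.lt_succ_of_le hj⟩, y)) :
    ∀ p, star (X p) = -X p := by
  -- the reflected family `−X*`
  have hbd : ∀ p, ‖-star (X p)‖ ≤ ‖X‖ := fun p => by
    rw [norm_neg, norm_star]; exact X.norm_coe_le_norm p
  set Y : XSpace d k 𝔸 := BoundedContinuousFunction.ofNormedAddCommGroupDiscrete (fun p => -star (X p)) ‖X‖ hbd with hYdef
  have hYp : ∀ p, Y p = -star (X p) := fun p => rfl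
  have hYρ : ‖Y‖ ≤ α₄ / (2 * B₀') :=
    ((BoundedContinuousFunction.norm_le (norm_nonneg X)).2 fun p => by rw [hYp]; exact hbd p).trans hXρ
  have hYzero : ∀ (j : ℕ) (hj : j ≤ k) (y : Site d), y ∉ Λs j → Y (⟨j, Nat.lt_succ_of_le hj⟩, y) = 0 := fun j hj y hy => by
    rw [hYp, hXzero j hj y hy, star_zero, neg_zero]
  have hHY : H' Y = fun x => -star (H' X x) := funext (hHequiv X Y hYp)
  have hHth : ∀ x, H' th x = -star (H' th x) := fun x => by
    have h := hHequiv th th (fun p => by rw [hth p, neg_neg]) x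
    exact h
  have hμ : ((-I) • lamOf s + H' th) - H' Y = fun x => -star ((((-I) • lamOf s + H' th) - H' X) x) := by
    funext x
    rw [hHY, Pi.sub_apply, Pi.add_apply, Pi.smul_apply, Pi.sub_apply, Pi.add_apply, Pi.smul_apply, star_sub, star_add,
      star_negI_smul_of_sa (hsa x)]
    have h1 : star (H' th x) = -H' th x := by
      have h := congrArg star (hHth x)
      rw [star_neg, star_star] at h
      rw [h]
    rw [h1]
    abel
  have hYfix : ∀ (j : ℕ) (hj : j ≤ k) (y : Site d), y ∈ Λs j →
      Cfam j (((-I) • lamOf s + H' th) - H' Y) y = Y (⟨j, Nat.lt_succ_of_le hj⟩, y) := by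
    intro j hj y hy
    obtain ⟨h119b, h119a⟩ := base_sub_119 (Λs := Λs) hL hη H' hEbT hH0 hH1 th hτ s hs
    obtain ⟨ha, hb⟩ := dom120_of_119_tower H' hB (by positivity) hH0 ((hH1_tower hL hη H' hEbT hH1) j hj y hy) (h119a j hj y hy)
      (h119b j hj y hy) hXρ
    rw [hμ, hCreal j hj y hy _ hb ha, hXfix j hj y hy, hYp]
  have hXY := familyE_lipschitz hL hη H' hB hCl hEbT hH0 hH1 hC125 hClB th hτ s s hs hs hXρ hYρ hXzero hXfix hYzero hYfix
  rw [sub_self, norm_zero, mul_zero] at hXY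
  have hXYeq : X = Y := sub_eq_zero.1 (norm_le_zero_iff.1 hXY)
  intro p
  have h1 : X p = -star (X p) := by rw [← hYp p, ← hXYeq]
  have h2 := congrArg star h1
  rw [star_neg, star_star] at h2
  exact h2

end FamilyE

end Literature.MathematicalPhysics.QuantumFieldTheory.Balaban1983to89.B8SectEKLevelFamilyBase

end
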